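import Summits.ABC.StewartYu.PadicG3StepPacks
import Summits.ABC.StewartYu.PadicG3Start
import Summits.ABC.StewartYu.PadicG3Output
import HarnessLib

/-!
# Cell abc-stewartyu, crux `Y07Odd` (stmt-ABC-19658), line `gen3-slab-odd`: the SCHEDULE INDUCTION of the odd-`p` frame — from the level-`0`
# state through `Ŝ` Kummer half-steps (each followed by its k-steps) to the frame output

`Summits/ABC/StewartYu/PadicG3Schedule.lean` — cell `abc-stewartyu` (seat p2-g4, F-odd lead).  Definitions (`Rl` level polynomials `feldR ∘ (2^{Ŝ−lev}Y₀)`,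
`Lb` level boxes `2s/2^{lev}`, `LevelState`) and theorems; no named fact; no numerics (every inequality is a record package of `PadicG3StepPacks`).

* `kchain` — `k` consecutive symmetric k-steps at one level;
* `levelUp` — `(lev, n) → (lev+1, n)`: half-step, odd-node k-step, `n − 1` k-steps; keeps `B ⊆ U`, the injectivity of the exponents in `λ`,
  and the coefficient vector;
* `levels` — induction on the level; **`frameOutput_of_schedule`** — level-`0` state at `(0, n)` + all packages ⇒
  `FrameOutputTwo n α b j₀ L₀ S₀ X′ (2·Lb Ŝ)`.

References: Yu. V. Nesterenko, LNM 1819 (2003) Prop. 4.1; K. Yu, Acta Math. 211 (2013) §5–§6.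
-/

noncomputable section

open NormedSpace Finset Polynomial
open Literature.NumberTheory.Transcendental
open Literature.NumberTheory.Transcendental.CW77.Setup (Tau tauNorm)
open Summit.ABC.StewartYu.FeldmanBasis (feldR)
open scoped Nat

namespace Summit.ABC.StewartYu

namespace G3Setup

variable {p : ℕ} [Fact p.Prime] (S : G3Setup p)

/-- The level-`lev` `Y₀`-polynomials `Δ(2^{Ŝ−lev} Y₀; ℓ₀, H)`. [cite: Nesterenko2003, (4.20)] -/
def Rl (H Sh lev : ℕ) (i : ℕ × (Fin S.n → ℤ)) : ℚ[X] := (feldR i.1 H).comp (C ((2 : ℚ) ^ (Sh - lev)) * X)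

/-- The level-`lev` box sides `2s_j / 2^{lev}` (iterated halving). [cite: Nesterenko2003, §4.3] -/
def Lb (s : Fin S.n → ℕ) : ℕ → Fin S.n → ℕ
  | 0 => fun j => 2 * s j
  | lev + 1 => fun j => Lb s lev j / 2

/-- At the last level the polynomials are `feldR` itself (as far as Hasse values go). [folklore] -/
theorem hasse_Rl_last (H Sh : ℕ) (i : ℕ × (Fin S.n → ℤ)) (t : ℕ) (x : ℤ) :
    (hasseDeriv t (S.Rl H Sh Sh i)).eval (x : ℚ) = (hasseDeriv t (feldR i.1 H)).eval (x : ℚ) := by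
  unfold Rl
  rw [Nat.sub_self, pow_zero, C_1, one_mul, comp_X]

/-- **The state at the end of a level**: some sub-family of `U` with exponents injective in `λ` satisfying the invariant. [folklore] -/
def LevelState (H Sh : ℕ) (s : Fin S.n → ℕ) (U : Finset (ℕ × (Fin S.n → ℤ))) (pv : ℕ × (Fin S.n → ℤ) → ℤ) (P : ℤ) (m lev N T : ℕ) :
    Prop :=
  ∃ (B : Finset (ℕ × (Fin S.n → ℤ))) (v : ℕ × (Fin S.n → ℤ) → Fin S.n → ℤ) (sgn : ℕ × (Fin S.n → ℤ) → ℤ) (lo : Fin S.n → ℤ),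
    B ⊆ U ∧ (∀ i ∈ B, ∀ i' ∈ B, v i = v i' ↔ i.2 = i'.2) ∧
    S.LvInvI (S.Rl H Sh lev) B v sgn pv lo (S.Lb s lev) P m {x : ℤ | |x| ≤ (N : ℤ)} T

variable {S}

/-- **`k` consecutive k-steps at one level.** [cite: Nesterenko2003, §4.2] -/
theorem kchain {ι : Type*} {R : ι → ℚ[X]} {U B : Finset ι} {v : ι → Fin S.n → ℤ} {sgn pv : ι → ℤ} {lo : Fin S.n → ℤ}
    {L : Fin S.n → ℕ} {P : ℤ} {m : ℕ} (hBU : B ⊆ U) (hΛ : ‖S.Λ / (S.b S.j₀ : ℚ_[p])‖ ≤ (p : ℝ)⁻¹)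
    (N T : ℕ → ℕ) (ν₀ : ℕ) :
    ∀ k : ℕ, (∀ ν, ν₀ ≤ ν → ν < ν₀ + k → S.KStepHypU R U L P m (N ν) (N (ν + 1)) (T ν) (T (ν + 1))) →
      S.LvInvI R B v sgn pv lo L P m {x : ℤ | |x| ≤ (N ν₀ : ℤ)} (T ν₀) →
      S.LvInvI R B v sgn pv lo L P m {x : ℤ | |x| ≤ (N (ν₀ + k) : ℤ)} (T (ν₀ + k)) := by
  intro k
  induction k with
  | zero => intro _ h; simpa using h
  | succ k ih =>
    intro hyp h
    have h1 := ih (fun ν h0 h1 => hyp ν h0 (by omega)) h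
    have h2 := LvInvI.kstep_of_hypU hBU h1 hΛ (hyp (ν₀ + k) (by omega) (by omega))
    rwa [show ν₀ + (k + 1) = ν₀ + k + 1 by omega]

/-- **One level up**: `(lev, n) → (lev+1, n)` = half-step + odd-node k-step + `n − 1` k-steps. [cite: Nesterenko2003, §4.2–4.3] -/
theorem levelUp {H Sh : ℕ} {s : Fin S.n → ℕ} {U : Finset (ℕ × (Fin S.n → ℤ))} {pv : ℕ × (Fin S.n → ℤ) → ℤ} {P : ℤ} {m : ℕ}
    (hn : 1 ≤ S.n) (hΛ : ‖S.Λ / (S.b S.j₀ : ℚ_[p])‖ ≤ (p : ℝ)⁻¹) (hΛm : ‖S.Λ / (S.b S.j₀ : ℚ_[p])‖ ≤ (p : ℝ)⁻¹ ^ (m + 1))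
    {ζ : ℚ_[p]} (hζ : IsPrimitiveRoot ζ (p - 1)) (hζM : ζ ^ ((p - 1) / 2) = -1) (hζ1 : ‖ζ‖ = 1) (r : Fin S.n → ℕ)
    (hη : ∀ j, S.η j = ζ ^ r j)
    (hind : ∀ T₁ : Finset (Fin S.n), T₁.Nonempty → ¬ IsSquare (∏ j ∈ T₁, S.α j) ∧ ¬ IsSquare (-∏ j ∈ T₁, S.α j))
    (N T : ℕ → ℕ → ℕ) (Nh : ℕ → ℕ) (lev : ℕ)
    (hH : S.HalfStepHypU (S.Rl H Sh lev) (S.Rl H Sh (lev + 1)) U (S.Lb s lev) P m (N lev S.n) (Nh (lev + 1)) (T lev S.n) (T (lev + 1) 0))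
    (hO : S.KStepOddHypU (S.Rl H Sh (lev + 1)) U (S.Lb s (lev + 1)) P m (Nh (lev + 1)) (N (lev + 1) 1) (T (lev + 1) 0) (T (lev + 1) 1))
    (hK : ∀ ν, 1 ≤ ν → ν < S.n → S.KStepHypU (S.Rl H Sh (lev + 1)) U (S.Lb s (lev + 1)) P m (N (lev + 1) ν) (N (lev + 1) (ν + 1))
      (T (lev + 1) ν) (T (lev + 1) (ν + 1)))
    (hst : S.LevelState H Sh s U pv P m lev (N lev S.n) (T lev S.n)) :
    S.LevelState H Sh s U pv P m (lev + 1) (N (lev + 1) S.n) (T (lev + 1) S.n) := by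
  classical
  obtain ⟨B, v, sgn, lo, hBU, hinj, h⟩ := hst
  obtain ⟨i₀, hi₀B, _, h1⟩ := LvInvI.halfStep_of_hypU hBU h hΛ hΛm hζ hζM hζ1 r hη hind hH
  have hB'U : S.pivotClass v sgn B i₀ ⊆ U := (S.pivotClass_subset v sgn B i₀).trans hBU
  have h2 := LvInvI.kstep_odd_of_hypU hB'U h1 hΛ hO
  have h3 := kchain hB'U hΛ (N (lev + 1)) (T (lev + 1)) 1 (S.n - 1) (fun ν h0 h1 => hK ν h0 (by omega)) h2
  rw [show 1 + (S.n - 1) = S.n by omega] at h3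
  refine ⟨S.pivotClass v sgn B i₀, S.halfDiff v i₀, S.sgnOf (S.halfDiff v i₀), _, hB'U, ?_, h3⟩
  -- injectivity of the new exponents in `λ`
  intro i hi i' hi'
  have hiB : i ∈ B := S.pivotClass_subset v sgn B i₀ hi
  have hi'B : i' ∈ B := S.pivotClass_subset v sgn B i₀ hi'
  have hpar : ∀ j, 2 ∣ v i j - v i₀ j := (S.mem_pivotClass.mp hi).2.1
  have hpar' : ∀ j, 2 ∣ v i' j - v i₀ j := (S.mem_pivotClass.mp hi').2.1
  rw [← hinj i hiB i' hi'B]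
  constructor
  · intro hw
    have e1 := S.eq_add_two_smul_halfDiff v i₀ hpar (i := i)
    have e2 := S.eq_add_two_smul_halfDiff v i₀ hpar' (i := i')
    rw [e1, e2, hw]
  · intro hv
    funext j; simp only [halfDiff, hv]

/-- **All the levels.** [cite: Nesterenko2003, Prop 4.1] -/
theorem levels {H Sh : ℕ} {s : Fin S.n → ℕ} {U : Finset (ℕ × (Fin S.n → ℤ))} {pv : ℕ × (Fin S.n → ℤ) → ℤ} {P : ℤ} {m : ℕ}
    (hn : 1 ≤ S.n) (hΛ : ‖S.Λ / (S.b S.j₀ : ℚ_[p])‖ ≤ (p : ℝ)⁻¹) (hΛm : ‖S.Λ / (S.b S.j₀ : ℚ_[p])‖ ≤ (p : ℝ)⁻¹ ^ (m + 1))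
    {ζ : ℚ_[p]} (hζ : IsPrimitiveRoot ζ (p - 1)) (hζM : ζ ^ ((p - 1) / 2) = -1) (hζ1 : ‖ζ‖ = 1) (r : Fin S.n → ℕ)
    (hη : ∀ j, S.η j = ζ ^ r j)
    (hind : ∀ T₁ : Finset (Fin S.n), T₁.Nonempty → ¬ IsSquare (∏ j ∈ T₁, S.α j) ∧ ¬ IsSquare (-∏ j ∈ T₁, S.α j))
    (N T : ℕ → ℕ → ℕ) (Nh : ℕ → ℕ)
    (hH : ∀ lev < Sh, S.HalfStepHypU (S.Rl H Sh lev) (S.Rl H Sh (lev + 1)) U (S.Lb s lev) P m (N lev S.n) (Nh (lev + 1)) (T lev S.n) (T (lev + 1) 0))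
    (hO : ∀ lev < Sh, S.KStepOddHypU (S.Rl H Sh (lev + 1)) U (S.Lb s (lev + 1)) P m (Nh (lev + 1)) (N (lev + 1) 1) (T (lev + 1) 0)
      (T (lev + 1) 1))
    (hK : ∀ lev < Sh, ∀ ν, 1 ≤ ν → ν < S.n → S.KStepHypU (S.Rl H Sh (lev + 1)) U (S.Lb s (lev + 1)) P m (N (lev + 1) ν)
      (N (lev + 1) (ν + 1)) (T (lev + 1) ν) (T (lev + 1) (ν + 1)))
    (h0 : S.LevelState H Sh s U pv P m 0 (N 0 S.n) (T 0 S.n)) :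
    ∀ lev ≤ Sh, S.LevelState H Sh s U pv P m lev (N lev S.n) (T lev S.n) := by
  intro lev
  induction lev with
  | zero => intro _; exact h0
  | succ lev ih =>
    intro hle
    exact levelUp hn hΛ hΛm hζ hζM hζ1 r hη hind N T Nh lev (hH lev (by omega)) (hO lev (by omega)) (hK lev (by omega))
      (ih (by omega))

/-- **The frame output from the schedule**: the last level's state gives `FrameOutputTwo n α b j₀ L₀ S₀ X′ (2·Lb Ŝ)`.
[cite: Nesterenko2003, §5.1] -/
theorem frameOutput_of_levelState {H Sh L₀ : ℕ} {s : Fin S.n → ℕ} {𝔏 : Finset (Fin S.n → ℤ)} {pv : ℕ × (Fin S.n → ℤ) → ℤ} {P : ℤ}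
    {m N T X' S₀ : ℕ} (hst : S.LevelState H Sh s (S.unk L₀ 𝔏) pv P m Sh N T)
    (hX : 2 * ((S.n + 1) * X') ≤ N) (hS : (S.n + 1) * S₀ < T) :
    GenThreeFrameSpecTwo.FrameOutputTwo S.n S.α S.b S.j₀ L₀ S₀ X' (fun j => 2 * S.Lb s Sh j) := by
  classical
  obtain ⟨B, v, sgn, lo, hBU, hinj, h⟩ := hst
  have h' : S.LvInvI (fun i => feldR i.1 H) B v sgn pv lo (S.Lb s Sh) P m {x : ℤ | |x| ≤ (N : ℤ)} T :=
    h.congr_R fun i _ t x => S.hasse_Rl_last H Sh i t x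
  refine h'.frameOutput (fun i hi => ?_) hinj hX hS
  have := hBU hi
  unfold unk at this
  have := (mem_product.mp this).1
  rw [mem_range] at this
  omega

end G3Setup

end Summit.ABC.StewartYu

end
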